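/-
Origin: expansion seat `planner-pub-hodgecm-pv03-0`, handover v5/v5.1 2026-08-18T04:05:52Z / 04:12:44Z (`HOME/pub-hodgecm-pv03/lean/Pv03/PerL34/BallCocycle.lean`, md5 917d45e4, 210 lines);
landed by the gen-5 packager in gate run 21 as `HodgeCM/PerL34/BallCocycle.lean` (verbatim).
-/
/-
Copyright: pub-hodgecm formalisation cell (harness21, 2026). New file (not vendored).
Origin: HOME/pub-hodgecm-pv03/lean/Pv03/PerL34/BallCocycle.lean (WIP module `Pv03.PerL34.BallCocycle`; intended final
place `HodgeCM/PerL34/BallCocycle.lean` = module `HodgeCM.PerL34.BallCocycle`) (seat planner-pub-hodgecm-pv03-0, DAG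
node N33, PerL v5 Prop 4.3, tex ll. 667–682).
-/
import Summits.HodgeConjecture.HodgeCM.PerL34.Ball_2

/-!
# The Jacobian cocycle of `U(2,1)` on `𝔹²`: chain rule and the isotropy action on cotangent lines

Continuation of `Ball.lean` (pure Mathlib, everything PROVED):

* `Jac_mul : Jac (g * h) z = Jac g (h • z) * Jac h z` — the chain rule for the Jacobian matrices of the
  projective fractional-linear action (an identity of rational functions, from `w = g · w'`);
  `Jac_one`, `Jac_inv_mul`;
* `Jac_kU : Jac (kU s) x₀ = !![s 1 1, -s 1 0; -s 0 1, s 0 0]` (`= (s⁻¹)ᵀ` for `s ∈ SU(2)`);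
* `su2Of a b : !![a, -conj b; b, conj a] ∈ SU(2)` when `|a|² + |b|² = 1`;
* `wedge_mulVec : wedge (M a) (M b) = det M · wedge a b` for `wedge a b = a₀ b₁ - a₁ b₀`;
* **`irred`**: for every `x ∈ 𝔹²` and every `v ≠ 0` in `ℂ² = T^*_x 𝔹²` there is an isotropy element `k` of `x`
  with `wedge ((Jac k x)ᵀ v) v ≠ 0` — NO LINE of `T^*_x 𝔹²` is stable under the stabiliser of `x`
  (PerL ll. 677–681: "`K_x ≅ U(2) × U(1)` acts on `T^*_x` by the standard representation of `U(2)` twisted by a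
  character, and `SU(2)` is transitive on lines").  Proof: conjugate the `SU(2) ⊂ K_{x₀}` of `Ball.lean` by a
  `g` with `g • x₀ = x` (transitivity) and use the chain rule.

These are exactly the "PRINT (elementary)" fields `trans`, `irred`, `contJ`, `unitJ`, `csmul` of
`HodgeCM.Universe.ThetaModel.BallFacts` (`HodgeCM/Automorphic/ThetaWedgeSplit.lean`) for the canonical ball datum;
see `BallUniformisation.lean`.
-/

noncomputable section

open Matrix Complex ComplexConjugate

namespace HodgeCM
namespace PerL34
namespace BallModel

/-! ## Chain rule -/

/-- (Ported verbatim from the HodgeCMPerL package; no docstring in the source.) -/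
theorem W3_mul (g h : U21) (z : Ball) : W3 (g * h) z = mat g *ᵥ W3 h z := by
  unfold W3; rw [mat_mul, ← Matrix.mulVec_mulVec]

/-- (Ported verbatim from the HodgeCMPerL package; no docstring in the source.) -/
theorem W3_smul (g h : U21) (z : Ball) (k : Fin 3) : W3 g (h • z) k = (W3 h z 2)⁻¹ * (mat g *ᵥ W3 h z) k := by
  rw [smul_def]
  unfold W3
  rw [lift_act, Matrix.mulVec_smul]
  rfl

/-- **Chain rule** for the Jacobian matrices of the action. -/
theorem Jac_mul (g h : U21) (z : Ball) : Jac (g * h) z = Jac g (h • z) * Jac h z := by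
  have hc : W3 h z 2 ≠ 0 := W3_2_ne_zero h z
  have hd : W3 (g * h) z 2 ≠ 0 := W3_2_ne_zero (g * h) z
  rw [W3_mul] at hd
  ext i k
  simp only [Jac, Matrix.mul_apply, Matrix.of_apply, Fin.sum_univ_two, W3_smul, W3_mul, mat_mul,
    Fin.sum_univ_three, Matrix.mulVec, dotProduct, Fin.castSucc_zero, Fin.castSucc_one, Fin.isValue] at hd ⊢
  field_simp
  ring

/-- (Ported verbatim from the HodgeCMPerL package; no docstring in the source.) -/
theorem W3_one (z : Ball) : W3 1 z = lift z := by
  unfold W3; rw [mat_one, Matrix.one_mulVec]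

/-- (Ported verbatim from the HodgeCMPerL package; no docstring in the source.) -/
theorem Jac_one (z : Ball) : Jac 1 z = 1 := by
  ext i j
  fin_cases i <;> fin_cases j <;> simp [Jac, W3_one, Matrix.one_apply]

/-- (Ported verbatim from the HodgeCMPerL package; no docstring in the source.) -/
theorem Jac_inv_mul (g : U21) (z : Ball) : Jac g⁻¹ (g • z) * Jac g z = 1 := by
  rw [← Jac_mul, inv_mul_cancel, Jac_one]

/-- (Ported verbatim from the HodgeCMPerL package; no docstring in the source.) -/
theorem Jac_mul_inv (g : U21) (z : Ball) : Jac g z * Jac g⁻¹ (g • z) = 1 :=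
  mul_eq_one_comm.1 (Jac_inv_mul g z)

/-! ## The Jacobian of the isotropy elements `k(s)` at `x₀` -/

/-- (Ported verbatim from the HodgeCMPerL package; no docstring in the source.) -/
theorem Jac_kU (s : Matrix (Fin 2) (Fin 2) ℂ) (hs : s ∈ Matrix.specialUnitaryGroup (Fin 2) ℂ) :
    Jac (kU s hs) x₀ = !![s 1 1, -s 1 0; -s 0 1, s 0 0] := by
  obtain ⟨r00, r10, r01, r11, -⟩ := su2_rel hs
  have hW2 : W3 (kU s hs) x₀ 2 = 1 := by rw [W3_apply]; simp [kmat]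
  have hW0 : W3 (kU s hs) x₀ 0 = 0 := by rw [W3_apply]; simp [kmat]
  have hW1 : W3 (kU s hs) x₀ 1 = 0 := by rw [W3_apply]; simp [kmat]
  ext i j
  fin_cases i <;> fin_cases j <;> simp [Jac, hW2, hW0, hW1, kmat, r00, r01, r10, r11]

/-- (Ported verbatim from the HodgeCMPerL package; no docstring in the source.) -/
theorem Jac_kU_transpose_mulVec (s : Matrix (Fin 2) (Fin 2) ℂ) (hs : s ∈ Matrix.specialUnitaryGroup (Fin 2) ℂ)
    (u : Fin 2 → ℂ) :
    (Jac (kU s hs) x₀)ᵀ *ᵥ u = ![s 1 1 * u 0 - s 0 1 * u 1, -(s 1 0 * u 0) + s 0 0 * u 1] := by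
  rw [Jac_kU]
  ext i
  fin_cases i <;> simp [Matrix.mulVec, dotProduct, Fin.sum_univ_two, Matrix.transpose_apply, sub_eq_add_neg]

/-! ## A standard parametrisation of `SU(2)` -/

/-- `!![a, -b̄; b, ā]`. -/
def su2Mat (a b : ℂ) : Matrix (Fin 2) (Fin 2) ℂ := !![a, -conj b; b, conj a]

/-- (Ported verbatim from the HodgeCMPerL package; no docstring in the source.) -/
theorem su2Mat_mem (a b : ℂ) (h : conj a * a + conj b * b = 1) :
    su2Mat a b ∈ Matrix.specialUnitaryGroup (Fin 2) ℂ := by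
  rw [Matrix.mem_specialUnitaryGroup_iff]
  refine ⟨?_, ?_⟩
  · rw [Matrix.mem_unitaryGroup_iff']
    ext i j
    fin_cases i <;> fin_cases j <;>
      simp [su2Mat, Matrix.mul_apply, Fin.sum_univ_two, Matrix.star_apply] <;>
      first | linear_combination h | ring1
  · rw [Matrix.det_fin_two]
    simp [su2Mat]
    linear_combination h

/-! ## The elementary wedge of two vectors of `ℂ²` -/

/-- `a ∧ b = a₀ b₁ - a₁ b₀` (the same expression as `HodgeCM.LineField.wedge2`). -/
def wedge (a b : Fin 2 → ℂ) : ℂ := a 0 * b 1 - a 1 * b 0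

/-- (Ported verbatim from the HodgeCMPerL package; no docstring in the source.) -/
theorem wedge_mulVec (M : Matrix (Fin 2) (Fin 2) ℂ) (a b : Fin 2 → ℂ) :
    wedge (M *ᵥ a) (M *ᵥ b) = M.det * wedge a b := by
  simp [wedge, Matrix.mulVec, dotProduct, Fin.sum_univ_two, Matrix.det_fin_two]; ring

/-- (Ported verbatim from the HodgeCMPerL package; no docstring in the source.) -/
theorem nsq_eq (u : Fin 2 → ℂ) : ((nsq u : ℝ) : ℂ) = conj (u 0) * u 0 + conj (u 1) * u 1 := by
  unfold nsq; rw [Complex.conj_mul', Complex.conj_mul']; push_cast; ring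

/-- At `x₀`: every nonzero cotangent vector is moved off its line by some `k(s)`, `s ∈ SU(2)`. -/
theorem exists_kU_wedge_ne_zero (u : Fin 2 → ℂ) (hu : u ≠ 0) :
    ∃ (s : Matrix (Fin 2) (Fin 2) ℂ) (hs : s ∈ Matrix.specialUnitaryGroup (Fin 2) ℂ),
      wedge ((Jac (kU s hs) x₀)ᵀ *ᵥ u) u ≠ 0 := by
  have hn : 0 < nsq u := nsq_pos_of_ne_zero hu
  set r : ℝ := Real.sqrt (nsq u) with hr_def
  have hr : 0 < r := Real.sqrt_pos.2 hn
  have hr2 : (r : ℂ) ^ 2 = conj (u 0) * u 0 + conj (u 1) * u 1 := by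
    rw [← nsq_eq]; exact_mod_cast Real.sq_sqrt hn.le
  have hrC : (r : ℂ) ≠ 0 := by exact_mod_cast hr.ne'
  have hq : (conj (u 0) * u 0 + conj (u 1) * u 1) / r = r := by
    rw [← hr2, pow_two, mul_div_assoc, div_self hrC, mul_one]
  by_cases h1 : u 1 = 0
  · -- then `u 0 ≠ 0`; with `(a, b) = (-ū₁, ū₀)/r`, `ᵗJac(k(s))` sends `u` to `(0, -r)`
    have h0 : u 0 ≠ 0 := by
      intro h0
      apply hu
      funext i
      fin_cases i
      · exact h0
      · exact h1
    have hab : conj (-conj (u 1) / r) * (-conj (u 1) / r) + conj (conj (u 0) / r) * (conj (u 0) / r) = 1 := by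
      simp only [map_neg, map_div₀, Complex.conj_conj, Complex.conj_ofReal]
      field_simp
      first | linear_combination hr2 | linear_combination -hr2
    refine ⟨su2Mat (-conj (u 1) / r) (conj (u 0) / r), su2Mat_mem _ _ hab, ?_⟩
    have key : wedge ((Jac (kU _ (su2Mat_mem _ _ hab)) x₀)ᵀ *ᵥ u) u =
        (conj (u 0) * u 0 + conj (u 1) * u 1) / r * u 0 := by
      rw [Jac_kU_transpose_mulVec]
      simp only [wedge, su2Mat, Matrix.of_apply, Matrix.cons_val', Matrix.cons_val_zero, Matrix.cons_val_one,
        Matrix.empty_val', Matrix.cons_val_fin_one, Complex.conj_conj, map_neg, map_div₀, Complex.conj_ofReal]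
      field_simp
      ring
    rw [key, hq]
    exact mul_ne_zero hrC h0
  · -- with `(a, b) = (u₀, u₁)/r`, `ᵗJac(k(s))` sends `u` to `(r, 0)`
    have hab : conj (u 0 / r) * (u 0 / r) + conj (u 1 / r) * (u 1 / r) = 1 := by
      simp only [map_div₀, Complex.conj_ofReal]
      field_simp
      first | linear_combination hr2 | linear_combination -hr2
    refine ⟨su2Mat (u 0 / r) (u 1 / r), su2Mat_mem _ _ hab, ?_⟩
    have key : wedge ((Jac (kU _ (su2Mat_mem _ _ hab)) x₀)ᵀ *ᵥ u) u =
        (conj (u 0) * u 0 + conj (u 1) * u 1) / r * u 1 := by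
      rw [Jac_kU_transpose_mulVec]
      simp only [wedge, su2Mat, Matrix.of_apply, Matrix.cons_val', Matrix.cons_val_zero, Matrix.cons_val_one,
        Matrix.empty_val', Matrix.cons_val_fin_one, map_div₀, Complex.conj_ofReal]
      field_simp
      ring
    rw [key, hq]
    exact mul_ne_zero hrC h1

/-! ## No stable line at any point -/

/-- **irred:** for every point `x` of the ball and every nonzero `v ∈ ℂ² = T^*_x 𝔹²` some element of the
stabiliser of `x` moves `v` off its line (through the transpose Jacobian). -/
theorem irred (x : Ball) (v : Fin 2 → ℂ) (hv : v ≠ 0) :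
    ∃ k : U21, k • x = x ∧ wedge ((Jac k x)ᵀ *ᵥ v) v ≠ 0 := by
  obtain ⟨g, rfl⟩ := exists_smul_x₀_eq x
  have hPP' : Jac g x₀ * Jac g⁻¹ (g • x₀) = 1 := Jac_mul_inv g x₀
  have hv' : v = (Jac g⁻¹ (g • x₀))ᵀ *ᵥ ((Jac g x₀)ᵀ *ᵥ v) := by
    rw [Matrix.mulVec_mulVec, ← Matrix.transpose_mul, hPP', Matrix.transpose_one, Matrix.one_mulVec]
  have hu : (Jac g x₀)ᵀ *ᵥ v ≠ 0 := by
    intro h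
    apply hv
    rw [hv', h, Matrix.mulVec_zero]
  obtain ⟨s, hs, hw⟩ := exists_kU_wedge_ne_zero _ hu
  refine ⟨g * kU s hs * g⁻¹, ?_, ?_⟩
  · rw [mul_smul, mul_smul, inv_smul_smul, kU_smul_x₀]
  · have hJ : Jac (g * kU s hs * g⁻¹) (g • x₀) = Jac g x₀ * Jac (kU s hs) x₀ * Jac g⁻¹ (g • x₀) := by
      rw [Jac_mul, inv_smul_smul, Jac_mul, kU_smul_x₀]
    rw [hJ, Matrix.transpose_mul, Matrix.transpose_mul, ← Matrix.mulVec_mulVec, ← Matrix.mulVec_mulVec]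
    conv_lhs => arg 2; rw [hv']
    rw [wedge_mulVec, Matrix.det_transpose]
    exact mul_ne_zero (det_Jac_ne_zero _ _) hw

/-- The transpose Jacobian is continuous in the group variable. -/
theorem continuous_Jac_transpose (z : Ball) : Continuous fun g : U21 => (Jac g z)ᵀ :=
  (continuous_Jac z).matrix_transpose

/-- The transpose Jacobian is invertible. -/
theorem isUnit_Jac_transpose (g : U21) (z : Ball) : IsUnit (Jac g z)ᵀ := by
  rw [Matrix.isUnit_iff_isUnit_det, Matrix.det_transpose, isUnit_iff_ne_zero]
  exact det_Jac_ne_zero g z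

end BallModel
end PerL34
end HodgeCM

end
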